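import Literature.Analysis.FunctionSpaces.PoissonPointProcess
import Mathlib.Probability.Kernel.MeasurableLIntegral
import Mathlib.Probability.Kernel.Basic
import Mathlib.MeasureTheory.Measure.Count
import Mathlib.MeasureTheory.Integral.Lebesgue.Countable
import Mathlib.Topology.Compactness.SigmaCompact
import HarnessLib

/-!
# The counting measure of a point configuration as an s-finite kernel; Campbell sums
(trunk T-KINETIC; topic Analysis/FunctionSpaces, next to `PoissonPointProcess`; serves the core
fact `Literature.MathematicalPhysics.KineticTheory.gallavotti_lorentz_tendsto_dual` of the Boltzmann–Grad limit of the Lorentz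
gas via the Mecke formula of `PoissonMecke`)

For a locally finite simple configuration `c : Literature.PointConfig E` we package its counting measure
`∑_{a ∈ c} δ_a` as `PointConfig.toMeasure c := Measure.count.restrict c`, and the map
`c ↦ c.toMeasure` as a kernel `PointConfig.countKernel : Kernel (PointConfig E) E` for the count
σ-algebra of `PoissonPointProcess`. On a σ-compact space the kernel is **s-finite**
(`PointConfig.instIsSFiniteKernelCountKernel`: split `E` into the compact shells of
`compactCovering` and each shell according to the (finite) number of points it contains), so
that Mathlib's kernel measurability applies: *Campbell sums* `c ↦ ∑_{a ∈ c} h(x, a)` of jointly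
measurable nonnegative `h` are jointly measurable in `(x, c)`
(`PointConfig.measurable_lintegral_toMeasure`, `PointConfig.measurable_tsum`), and so are the
counts `c ↦ N_c(S_x)` of measurably parametrised sets and the void events `{N_c(S_x) = 0}`
(`PointConfig.measurable_count_preimage`, `PointConfig.measurableSet_count_preimage_eq_zero`) —
the measurability inputs of Gallavotti's computation of the annealed Lorentz-gas expectations
(sums over tuples of scatterers, tubes void of scatterers). Standard point-process measure theory
(Last–Penrose, *Lectures on the Poisson Process* (2017), §2.1–2.2: Campbell's formula, Prop. 2.7;
Kallenberg, *Random Measures*).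

## References

* G. Last, M. Penrose, *Lectures on the Poisson Process*, Cambridge Univ. Press (2017), Ch. 2.
-/

open MeasureTheory ProbabilityTheory Set
open scoped ENNReal

namespace Literature.Analysis.FunctionSpaces

namespace PointConfig

variable {E : Type*} [TopologicalSpace E]

/-- A locally finite configuration in a σ-compact space is countable (it meets each of the
countably many compact sets `compactCovering E n` in a finite set). [folklore] -/
theorem countable_carrier [SigmaCompactSpace E] (c : PointConfig E) : (c : Set E).Countable := by
  have : (c : Set E) = ⋃ n, (c.carrier ∩ compactCovering E n) := by
    rw [← inter_iUnion, iUnion_compactCovering, inter_univ]; rfl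
  rw [this]
  exact countable_iUnion fun n => (c.finite_inter_isCompact _ (isCompact_compactCovering E n)).countable

variable [MeasurableSpace E]

/-- The *counting measure* `∑_{a ∈ c} δ_a` of a configuration: Mathlib's counting measure
restricted to the (countable) set of its points (Last–Penrose 2017 §2.1: a point process as a
random counting measure). [cite: LastPenrose2017, Def 2.1] -/
noncomputable def toMeasure (c : PointConfig E) : Measure E :=
  Measure.count.restrict (c : Set E)

/-- Unfolding lemma for `toMeasure`. [folklore] -/
theorem toMeasure_def (c : PointConfig E) : c.toMeasure = Measure.count.restrict (c : Set E) := rfl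

variable [MeasurableSingletonClass E] [SigmaCompactSpace E]

/-- The set of points of a configuration is measurable (countable). [folklore] -/
theorem measurableSet_carrier (c : PointConfig E) : MeasurableSet (c : Set E) :=
  c.countable_carrier.measurableSet

/-- The counting measure of `c` evaluated on a measurable set is the number of points of `c` in
it: `c.toMeasure s = N_c(s)`. [folklore] -/
theorem toMeasure_apply (c : PointConfig E) {s : Set E} (hs : MeasurableSet s) :
    c.toMeasure s = c.count s := by
  rw [toMeasure, Measure.restrict_apply hs, Measure.count_apply (hs.inter c.measurableSet_carrier),
    count, inter_comm]
  rfl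

/-- Integration against the counting measure of `c` is summation over its points:
`∫⁻ f d(c.toMeasure) = ∑_{a ∈ c} f a`. [folklore] -/
theorem lintegral_toMeasure (c : PointConfig E) (f : E → ℝ≥0∞) :
    ∫⁻ a, f a ∂c.toMeasure = ∑' a : (c : Set E), f a := by
  rw [toMeasure, lintegral_countable f c.countable_carrier]
  simp

omit [MeasurableSingletonClass E] [SigmaCompactSpace E] in
/-- The counting measure of the empty configuration is `0`. [folklore] -/
@[simp]
theorem toMeasure_empty : (∅ : PointConfig E).toMeasure = 0 := by
  rw [toMeasure]
  simp

/-- **The counting kernel** `c ↦ ∑_{a ∈ c} δ_a` from configurations (count σ-algebra) to `E`: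
measurable because its evaluations `c ↦ N_c(s)` are the generating counting maps.
[cite: LastPenrose2017, Prop 2.7] -/
noncomputable def countKernel : Kernel (PointConfig E) E where
  toFun := toMeasure
  measurable' := Measure.measurable_of_measurable_coe _ fun s hs => by
    simp_rw [toMeasure_apply _ hs]
    exact measurable_from_top.comp (measurable_count hs)

/-- The counting kernel applied to `c` is `c.toMeasure`. [folklore] -/
@[simp]
theorem countKernel_apply (c : PointConfig E) : countKernel c = c.toMeasure := rfl

section SFinite

variable [T2Space E] [OpensMeasurableSpace E]

/-- **The counting kernel is s-finite** on a σ-compact Hausdorff space: it is the countable sum,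
over the shells `A_n` of the compact exhaustion `compactCovering E` and over `m : ℕ`, of the
finite kernels "`c.toMeasure` restricted to `A_n` if `N_c(A_n) = m`, else `0`" (bounded by `m`).
This makes Mathlib's measurability of kernel integrals available for Campbell sums. [folklore] -/
instance instIsSFiniteKernelCountKernel : IsSFiniteKernel (countKernel (E := E)) := by
  -- the shells of the compact exhaustion
  set A : ℕ → Set E := disjointed (compactCovering E) with hA
  have hAm : ∀ n, MeasurableSet (A n) :=
    MeasurableSet.disjointed fun n => (isCompact_compactCovering E n).isClosed.measurableSet
  have hAd : Pairwise (Function.onFun Disjoint A) := disjoint_disjointed _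
  have hAU : (⋃ n, A n) = univ := by rw [hA, iUnion_disjointed, iUnion_compactCovering]
  have hAfin : ∀ (c : PointConfig E) (n : ℕ), (c.carrier ∩ A n).Finite := fun c n =>
    (c.finite_inter_isCompact _ (isCompact_compactCovering E n)).subset
      (inter_subset_inter_right _ (disjointed_subset _ _))
  -- the finite pieces
  set κ : ℕ × ℕ → Kernel (PointConfig E) E := fun p =>
    Kernel.piecewise (s := {c : PointConfig E | c.count (A p.1) = p.2})
      (measurableSet_eq_fun (measurable_count (hAm p.1)) measurable_const)
      ((countKernel (E := E)).restrict (hAm p.1)) 0 with hκ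
  have hκfin : ∀ p, IsFiniteKernel (κ p) := fun p => by
    refine ⟨⟨p.2, ENNReal.natCast_lt_top _, fun c => ?_⟩⟩
    rw [hκ]
    simp only [Kernel.piecewise_apply, mem_setOf_eq]
    split_ifs with hc
    · rw [Kernel.restrict_apply' _ _ _ MeasurableSet.univ, univ_inter, countKernel_apply,
        toMeasure_apply _ (hAm p.1), hc]
      simp
    · simp
  have hsum : Kernel.sum κ = countKernel (E := E) := by
    ext c s hs
    rw [Kernel.sum_apply' _ _ hs, countKernel_apply]
    -- sum over `m` first: only `m = N_c(A n)` contributes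
    have hinner : ∀ n, ∑' m, κ (n, m) c s = c.toMeasure (A n ∩ s) := fun n => by
      obtain ⟨m₀, hm₀⟩ : ∃ m₀ : ℕ, c.count (A n) = m₀ := by
        have hlt : c.count (A n) < ⊤ := by
          rw [count]; exact (hAfin c n).encard_lt_top
        exact ENat.ne_top_iff_exists.1 hlt.ne |>.imp fun m hm => hm.symm
      rw [tsum_eq_single m₀]
      · rw [hκ]
        simp only [Kernel.piecewise_apply, mem_setOf_eq, hm₀, if_true]
        rw [Kernel.restrict_apply' _ _ _ hs, countKernel_apply, inter_comm]
      · intro m hm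
        rw [hκ]
        simp only [Kernel.piecewise_apply, mem_setOf_eq, hm₀]
        rw [if_neg (fun h => hm (by exact_mod_cast h.symm))]
        simp
    rw [ENNReal.tsum_prod', tsum_congr hinner]
    -- sum over the shells
    rw [← measure_iUnion (fun i j hij => (hAd hij).mono inter_subset_left inter_subset_left)
      (fun n => (hAm n).inter hs), ← iUnion_inter, hAU, univ_inter]
  rw [← hsum]
  infer_instance

/-! ### Campbell sums and parametrised counts are measurable -/

/-- **Measurability of parametrised Campbell sums** (integral form): for jointly measurable
`f : α × E → [0, ∞]` and a measurable family of configurations `g a`, the map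
`a ↦ ∫⁻ f(a, x) d(g a).toMeasure = ∑_{x ∈ g a} f(a, x)` is measurable (Mathlib's measurability of
integrals against s-finite kernels; Last–Penrose 2017, Prop. 2.7 / Campbell). [cite: LastPenrose2017, Prop 2.7] -/
theorem measurable_lintegral_toMeasure {α : Type*} [MeasurableSpace α] {f : α × E → ℝ≥0∞}
    (hf : Measurable f) {g : α → PointConfig E} (hg : Measurable g) :
    Measurable fun a => ∫⁻ x, f (a, x) ∂(g a).toMeasure := by
  have h := Measurable.lintegral_kernel_prod_right' (κ := (countKernel (E := E)).comap g hg) hf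
  simpa only [Kernel.comap_apply, countKernel_apply] using h

/-- **Measurability of parametrised Campbell sums** (sum form): `a ↦ ∑_{x ∈ g a} f(a, x)` is
measurable for jointly measurable `f ≥ 0` and measurable `g`. In particular (with `α` carrying a
copy of the configuration itself) sums over points of `c` of functions of `(c, x)` and, by
iteration, sums over tuples of distinct points are measurable. [cite: LastPenrose2017, Prop 2.7] -/
theorem measurable_tsum_carrier {α : Type*} [MeasurableSpace α] {f : α × E → ℝ≥0∞}
    (hf : Measurable f) {g : α → PointConfig E} (hg : Measurable g) :
    Measurable fun a => ∑' x : ((g a : PointConfig E) : Set E), f (a, x) := by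
  have h := measurable_lintegral_toMeasure hf hg
  simp_rw [lintegral_toMeasure] at h
  exact h

/-- **Measurability of parametrised counts**: for a measurable `t ⊆ α × E` and a measurable
family of configurations `g a`, the number of points of `g a` in the section `{x | (a, x) ∈ t}`,
as an extended real, is measurable in `a`. [folklore] -/
theorem measurable_toMeasure_preimage {α : Type*} [MeasurableSpace α] {t : Set (α × E)}
    (ht : MeasurableSet t) {g : α → PointConfig E} (hg : Measurable g) :
    Measurable fun a => (g a).toMeasure (Prod.mk a ⁻¹' t) := by
  have h := Kernel.measurable_kernel_prodMk_left (κ := (countKernel (E := E)).comap g hg) ht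
  simpa only [Kernel.comap_apply, countKernel_apply] using h

/-- **Void events of parametrised sets are measurable**: `{a | N_{g a}({x | (a, x) ∈ t}) = 0}`
is measurable for measurable `t ⊆ α × E` and measurable `g` (e.g. "no scatterer in the tube
around the path determined by the parameters"). [folklore] -/
theorem measurableSet_count_preimage_eq_zero {α : Type*} [MeasurableSpace α] {t : Set (α × E)}
    (ht : MeasurableSet t) {g : α → PointConfig E} (hg : Measurable g) :
    MeasurableSet {a | (g a).count (Prod.mk a ⁻¹' t) = 0} := by
  have h : {a | (g a).count (Prod.mk a ⁻¹' t) = 0} =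
      (fun a => (g a).toMeasure (Prod.mk a ⁻¹' t)) ⁻¹' {0} := by
    ext a
    simp only [mem_setOf_eq, mem_preimage, mem_singleton_iff,
      toMeasure_apply _ (measurable_prodMk_left ht), ENat.toENNReal_eq_zero]
  rw [h]
  exact measurable_toMeasure_preimage ht hg (measurableSet_singleton 0)

end SFinite

end PointConfig

end Literature.Analysis.FunctionSpaces
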